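import Summits.KontsevichZagierPeriods.KontsevichZagierPeriods.Theses.SymplecticScissors
import Summits.KontsevichZagierPeriods.KontsevichZagierPeriods.Theorems.PlanarK0Injective.Negative.Kit
import Summits.KontsevichZagierPeriods.KontsevichZagierPeriods.Theorems.SymplecticScissorsPlanarCompilerStubElementaryMovesAux
import Summits.KontsevichZagierPeriods.KontsevichZagierPeriods.Theorems.SymplecticScissorsPlanarCompilerStubNormalFormAux
import Literature.NumberTheory.Transcendental.KZGroundingRelations

/-!
# Crux `SymplecticScissors.PlanarCompiler` (stmt-KontsevichZagierPeriods-10058), line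
`twist-restoring-shear`, stub `stub_normalForm`: the cylindrical normal form

Given an additive `Θ` on `KZ.FormalRep` with the CELL PROPERTY (it sends a 1-dimensional
representation `[∫_σ f]` to `[cell f⁺] − [cell f⁻]`, the honest integrand-`1` planar sets under
the graphs of `f` and `−f` over `σ`) and a planar set `r` (integrand `1` on an arbitrary
`ℚ`-semialgebraic `r.domain ⊆ ℝ²` of finite area), we produce a combination `c` of 1-dimensional
representations with `eval c = r.value` and `[r] − Θ c ∈ G`, `G = planarGroup` the planar
set-chain group (generated by the planar instances of rules (1a) and (2) among integrand-`1`
sets).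

Proof.  Take a cylindrical decomposition of the line adapted to `r.domain`
(`IsSemialgebraic.exists_cylindricalDecomposition_holds`, in the fibre form `exists_fibre_eq`):
over each base cell `C` the vertical fibres of `r.domain` are finitely many graphs `ξ_{C,j} x`
and bands `(ξ_{C,j-1} x, ξ_{C,j} x)`.  Graphs and cylinders over null cells are null planar
sets; over a cell of positive length every band is inner (an infinite band has infinite area,
`KZ.ne_zero_and_ne_last_of_bandOver_subset`).  By generic smoothness
(`KZ.exists_isOpen_contDiffOn`) each section is differentiable off a null `ℚ`-semialgebraic
subset of `C`; over the remaining good base `U ⊆ C` the band `{ξ_{j-1} < y < ξ_j}` is carried by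
the vertical shear `(x, y) ↦ (x, y − ξ_{j-1} x)` (one rule-(2) instance, Jacobian `1`) onto the
cell of `ξ_j − ξ_{j-1}` over `U`, which is the positive cell of `Θ [∫_U (ξ_j − ξ_{j-1})]`, the
negative cell being empty (`exists_band_piece`).  Cutting `r` into these bands is a finite
almost-partition (`ElementaryMoves.of_sub_sum_mem_planarGroup`), and `c := ∑ [∫_U (ξ_j − ξ_{j-1})]` has
`eval c = ∑ area(band) = r.value` because `G ≤ ker eval` and each width is the area of its band
(Newton–Leibniz down the closed band, `KZ.exists_band_sub_base_mem_newtonLeibnizRel`).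

Prior art for the cell-by-cell bookkeeping: `KZ.of_sub_of_mem_relations_cell`
(`KZGroundingRelations.lean`).  Sources: Kontsevich–Zagier 2001, §1.2 (the rules);
Basu–Pollack–Roy 2006, Cor. 5.7 (CAD); everything here is folklore bookkeeping.
-/

noncomputable section

open MeasureTheory Set
open scoped ContDiff
open Literature.NumberTheory.Transcendental Literature.ModelTheory.ExponentialFields
open Summit.KontsevichZagierPeriods.KontsevichZagierPeriods.Theses.SymplecticScissors
open Summit.KontsevichZagierPeriods.SymplecticScissors.PlanarK0InjectiveNegative

namespace Summit.KontsevichZagierPeriods.SymplecticScissors.PlanarCompilerProof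

namespace NormalForm

/-! ## One band: the piece lemma -/

/-- **One inner band is `Θ` of its width, modulo `planarGroup`.** Let `Θ` have the cell property,
`S ⊆ ℝ²` have finite area, `U ⊆ ℝ¹` be `ℚ`-semialgebraic with `ℚ`-semialgebraic sections
`ξ₀ < ⋯ < ξ_{l-1}` differentiable at every point of `U`, and let `0 < j < l` index an inner band
`{x ∈ U, ξ_{j-1} x < y < ξ_j x} ⊆ S`.  Then the open band `Ob` (integrand `1`) and the width
`ρ = [∫_U (ξ_j − ξ_{j-1})]` satisfy `[Ob] − Θ [ρ] ∈ planarGroup` (shear onto the cell of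
`ξ_j − ξ_{j-1}`, the cell of `−(ξ_j − ξ_{j-1})` being empty) and `ρ.value = Ob.value`
(Newton–Leibniz down the closed band, which is a null modification of `Ob`).
[Kontsevich–Zagier 2001, §1.2] [folklore] -/
theorem exists_band_piece (Θ : KZ.FormalRep →+ KZ.FormalRep)
    (hΘ : ∀ ρ : KZ.IntegralRep 1, ∃ s t : KZ.IntegralRep 2, s.domain = {p : Fin 2 → ℝ | (fun _ : Fin 1 => p 0) ∈ ρ.domain ∧ 0 < p 1 ∧ p 1 < ρ.integrand (fun _ : Fin 1 => p 0)} ∧ t.domain = {p : Fin 2 → ℝ | (fun _ : Fin 1 => p 0) ∈ ρ.domain ∧ 0 < p 1 ∧ p 1 < -ρ.integrand (fun _ : Fin 1 => p 0)} ∧ (∀ p ∈ s.domain, s.integrand p = 1) ∧ (∀ p ∈ t.domain, t.integrand p = 1) ∧ Θ (KZ.of ρ) = KZ.of s - KZ.of t)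
    {S : Set (Fin 2 → ℝ)} (hfin : volume S ≠ ⊤) {U : Set (Fin 1 → ℝ)} (hU : IsSemialgebraic ℚ U)
    {l : ℕ} (ξ : Fin l → (Fin 1 → ℝ) → ℝ) (hξ : ∀ i, IsSemialgebraicFunOn ℚ U (ξ i))
    (hmono : ∀ x ∈ U, StrictMono fun i => ξ i x)
    (hdiff : ∀ i, ∀ x ∈ U, DifferentiableAt ℝ (ξ i) x) {j : Fin (l + 1)} (h0 : j ≠ 0)
    (hl : j ≠ Fin.last l) (hsub : bandOver U ξ j ⊆ S) (hband : IsSemialgebraic ℚ (bandOver U ξ j)) :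
    ∃ (Ob : KZ.IntegralRep 2) (ρ : KZ.IntegralRep 1), Ob.domain = bandOver U ξ j ∧
      (Ob.integrand = fun _ => 1) ∧ KZ.of Ob - Θ (KZ.of ρ) ∈ planarGroup ∧ ρ.value = Ob.value := by
  -- the closed band and the width, related by Newton–Leibniz
  obtain ⟨Bd, b, hBdd, hBdi, hbd, hbi, hNL⟩ :=
    KZ.exists_band_sub_base_mem_newtonLeibnizRel hfin hU ξ hξ hmono h0 hl hsub
  -- the open band
  obtain ⟨Ob, hObd, hObi⟩ :=
    KZ.exists_oneRep hband ((measure_mono hsub).trans_lt hfin.lt_top).ne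
  -- the cells of `Θ [b]`
  obtain ⟨s, t, hsd, htd, hs1, ht1, hΘb⟩ := hΘ b
  set lo : (Fin 1 → ℝ) → ℝ := fun x => (bandLower ξ j x).toReal with hlo_def
  set hi : (Fin 1 → ℝ) → ℝ := fun x => (bandUpper ξ j x).toReal with hhi_def
  have hlo : lo = ξ (j.pred h0) := by
    funext x
    simp only [hlo_def, bandLower_of_ne_zero ξ j h0, EReal.toReal_coe]
  have hhi : ∀ x, hi x = ξ (j.castPred hl) x := fun x => by
    simp only [hhi_def, bandUpper_of_ne_last ξ j hl, EReal.toReal_coe]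
  have hlt : ∀ x ∈ U, lo x < hi x := fun x hx =>
    KZ.toReal_bandLower_lt_toReal_bandUpper ξ (hmono x hx) h0 hl
  have hlosa : IsSemialgebraicFunOn ℚ U lo := hlo ▸ hξ _
  have hlod : ∀ y ∈ U, DifferentiableAt ℝ lo y := hlo ▸ hdiff _
  have hf : ∀ y ∈ U, b.integrand y = hi y - lo y := fun y _ => by rw [hbi]
  have hOb1 : ∀ z ∈ Ob.domain, Ob.integrand z = 1 := fun z _ => by rw [hObi]
  have hBd1 : ∀ z ∈ Bd.domain, Bd.integrand z = 1 := fun z _ => by rw [hBdi]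
  have hOb' : ∀ z, z ∈ Ob.domain ↔
      Fin.init z ∈ U ∧ lo (Fin.init z) < z (Fin.last 1) ∧ z (Fin.last 1) < hi (Fin.init z) := by
    intro z
    rw [hObd, mem_bandOver_iff, bandLower_of_ne_zero ξ j h0, bandUpper_of_ne_last ξ j hl,
      EReal.coe_lt_coe_iff, EReal.coe_lt_coe_iff, hlo, hhi]
  have hs' : ∀ p, p ∈ s.domain ↔
      (fun _ : Fin 1 => p 0) ∈ U ∧ 0 < p 1 ∧ p 1 < b.integrand (fun _ : Fin 1 => p 0) := by
    intro p
    rw [hsd, hbd]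
    rfl
  -- the cell of `-(ξ_j - ξ_{j-1})` is empty
  have ht0 : t.domain = ∅ := by
    rw [htd, hbd]
    refine eq_empty_of_forall_notMem fun p hp => ?_
    obtain ⟨hpU, h1, h2⟩ := hp
    rw [hf _ hpU] at h2
    linarith [hlt _ hpU]
  have htG : KZ.of t ∈ planarGroup :=
    of_mem_planarGroup_of_volume_eq_zero t ht1 (by rw [ht0, measure_empty])
  -- the shear
  have hshear : KZ.of Ob - KZ.of s ∈ planarGroup :=
    of_sub_of_mem_planarGroup_shear hlosa hlod hf Ob s hOb' hs' hOb1 hs1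
  -- the closed band is a null modification of the open band
  have hBdOb : KZ.of Bd - KZ.of Ob ∈ planarGroup := by
    refine ElementaryMoves.sub_mem_planarGroup_of_null Bd Ob hBd1 hOb1 ?_ ?_
    · have hhisa : IsSemialgebraicFunOn ℚ U hi := (hξ _).congr fun x _ => (hhi x).symm
      refine measure_mono_null (fun z hz => ?_)
        (measure_union_null (KZ.volume_graph_eq_zero hlosa) (KZ.volume_graph_eq_zero hhisa))
      rw [hBdd] at hz
      obtain ⟨hz, hz'⟩ := hz
      rw [KZlog.mem_band] at hz
      obtain ⟨hzU, h1, h2⟩ := hz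
      rcases h1.lt_or_eq with h1 | h1
      · rcases h2.lt_or_eq with h2 | h2
        · exact absurd ((hOb' z).2 ⟨hzU, h1, h2⟩) hz'
        · exact Or.inr ⟨hzU, h2⟩
      · exact Or.inl ⟨hzU, h1.symm⟩
    · rw [hBdd, show Ob.domain \ KZlog.band U lo hi = ∅ from
        Set.sdiff_eq_empty.mpr fun z hz => ?_, measure_empty]
      obtain ⟨hzU, h1, h2⟩ := (hOb' z).1 hz
      exact KZlog.mem_band.2 ⟨hzU, h1.le, h2.le⟩
  refine ⟨Ob, b, hObd, hObi, ?_, ?_⟩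
  · rw [hΘb, show KZ.of Ob - (KZ.of s - KZ.of t) = (KZ.of Ob - KZ.of s) + KZ.of t by abel]
    exact planarGroup.add_mem hshear htG
  · have e1 : KZ.eval (KZ.of Bd - KZ.of b) = 0 := KZ.eval_eq_zero_of_mem_newtonLeibnizRel_holds hNL
    have e2 : KZ.eval (KZ.of Bd - KZ.of Ob) = 0 := eval_eq_zero_of_mem_planarGroup hBdOb
    rw [map_sub, KZ.eval_of, KZ.eval_of, sub_eq_zero] at e1 e2
    rw [← e1, e2]

end NormalForm

open NormalForm

/-! ## The cylindrical normal form -/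

/-- **Stub 2 (L−).** Cylindrical normal form: every planar integrand-`1` representation is, modulo the planar set-chain group `G`, the `Θ`-image of a combination `c` of 1-dimensional representations with `eval c = area` (CAD of the domain; each band `{ξ_j < y < ξ_{j+1}}` is sheared onto the cell of `ξ_{j+1} − ξ_j`; graphs and the finitely many bad verticals are null). -/
theorem stub_normalForm :
    ∀ Θ : KZ.FormalRep →+ KZ.FormalRep, ((∀ ρ : KZ.IntegralRep 1, ∃ s t : KZ.IntegralRep 2, s.domain = {p : Fin 2 → ℝ | (fun _ : Fin 1 => p 0) ∈ ρ.domain ∧ 0 < p 1 ∧ p 1 < ρ.integrand (fun _ : Fin 1 => p 0)} ∧ t.domain = {p : Fin 2 → ℝ | (fun _ : Fin 1 => p 0) ∈ ρ.domain ∧ 0 < p 1 ∧ p 1 < -ρ.integrand (fun _ : Fin 1 => p 0)} ∧ (∀ p ∈ s.domain, s.integrand p = 1) ∧ (∀ p ∈ t.domain, t.integrand p = 1) ∧ Θ (KZ.of ρ) = KZ.of s - KZ.of t) ∧ (∀ (n : ℕ) (ρ : KZ.IntegralRep n), n ≠ 1 → Θ (KZ.of ρ) = 0)) → ∀ r : KZ.IntegralRep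 2, (∀ p ∈ r.domain, r.integrand p = 1) → ∃ c : KZ.FormalRep, c ∈ AddSubgroup.closure (Set.range fun ρ : KZ.IntegralRep 1 => KZ.of ρ) ∧ KZ.eval c = r.value ∧ KZ.of r - Θ c ∈ AddSubgroup.closure ((KZ.domainAddRel ∪ KZ.changeOfVariablesRel) ∩ (AddSubgroup.closure {x : KZ.FormalRep | ∃ s : KZ.IntegralRep 2, (∀ p ∈ s.domain, s.integrand p = 1) ∧ x = KZ.of s} : Set KZ.FormalRep)) := by
  classical
  intro Θ hΘ r hr
  obtain ⟨hΘ1, -⟩ := hΘ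
  -- the planar set and its area
  set S : Set (Fin 2 → ℝ) := r.domain with hS
  have hSsa : IsSemialgebraic ℚ S := r.isSemialgebraic_domain
  have hfin : volume S ≠ ⊤ := KZ.volume_ne_top_of_integrand_one r hr
  have hSm : MeasurableSet S := IsSemialgebraic.measurableSet_holds hSsa
  -- a cylindrical decomposition of the line adapted to `S`
  obtain ⟨𝒮, l, ξ, h𝒮, -, hsa, hmono, hcells, hfib⟩ :=
    IsSemialgebraic.exists_cylindricalDecomposition.exists_fibre_eq
      (IsSemialgebraic.exists_cylindricalDecomposition_holds (k := ℚ)) hSsa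
  have h𝒮part := h𝒮.isPartition
  have h𝒮sa := h𝒮.isSemialgebraic
  choose Gf Bf _hGsub hBsub hfibre using hfib
  -- generic smoothness of the sections: the good bases `U C ⊆ C`
  have hgood : ∀ (C : Set (Fin 1 → ℝ)) (hC : C ∈ 𝒮) (i : Fin (l C)), ∃ G : Set (Fin 1 → ℝ),
      G ⊆ C ∧ IsOpen G ∧ IsSemialgebraic ℚ G ∧ ContDiffOn ℝ ∞ (ξ C i) G ∧
        IsSemialgebraic ℚ (C \ G) ∧ volume (C \ G) = 0 := fun C hC i =>
    KZ.exists_isOpen_contDiffOn (h𝒮sa C hC) (hsa C hC i)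
  choose Gd _hGdC hGdo hGdsa hGdsm _hGdsa' hGd0 using hgood
  let U : {C // C ∈ 𝒮} → Set (Fin 1 → ℝ) := fun C =>
    C.1 ∩ ⋂ i ∈ (Finset.univ : Finset (Fin (l C.1))), Gd C.1 C.2 i
  have hUC : ∀ C, U C ⊆ C.1 := fun C => inter_subset_left
  have hUsa : ∀ C, IsSemialgebraic ℚ (U C) := fun C =>
    (h𝒮sa C.1 C.2).inter (IsSemialgebraic.biInter _ _ fun i _ => hGdsa C.1 C.2 i)
  have hU0 : ∀ C, volume (C.1 \ U C) = 0 := by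
    intro C
    have hcov : C.1 \ U C ⊆ ⋃ i ∈ (Finset.univ : Finset (Fin (l C.1))), (C.1 \ Gd C.1 C.2 i) := by
      intro x hx
      obtain ⟨hxC, hxU⟩ := hx
      have : ¬ ∀ i ∈ (Finset.univ : Finset (Fin (l C.1))), x ∈ Gd C.1 C.2 i := fun h =>
        hxU ⟨hxC, mem_iInter₂.2 h⟩
      push Not at this
      obtain ⟨i, hi, hxi⟩ := this
      exact mem_iUnion₂.2 ⟨i, hi, hxC, hxi⟩
    exact measure_mono_null hcov
      ((measure_biUnion_null_iff (Finset.countable_toSet _)).2 fun i _ => hGd0 C.1 C.2 i)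
  have hUdiff : ∀ (C : {C // C ∈ 𝒮}) (i : Fin (l C.1)), ∀ x ∈ U C, DifferentiableAt ℝ (ξ C.1 i) x := by
    intro C i x hx
    have hxG : x ∈ Gd C.1 C.2 i := (mem_iInter₂.1 hx.2) i (Finset.mem_univ i)
    exact ((hGdsm C.1 C.2 i).contDiffAt ((hGdo C.1 C.2 i).mem_nhds hxG)).differentiableAt
      (by simp)
  have hbandU : ∀ (C : {C // C ∈ 𝒮}) (j : Fin (l C.1 + 1)),
      bandOver (U C) (ξ C.1) j = bandOver C.1 (ξ C.1) j ∩ {z | Fin.init z ∈ U C} := by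
    intro C j
    ext z
    simp only [mem_bandOver_iff, mem_inter_iff, mem_setOf_eq]
    constructor
    · rintro ⟨hU, h1, h2⟩
      exact ⟨⟨hUC C hU, h1, h2⟩, hU⟩
    · rintro ⟨⟨-, h1, h2⟩, hU⟩
      exact ⟨hU, h1, h2⟩
  have hbandsa : ∀ (C : {C // C ∈ 𝒮}) (j : Fin (l C.1 + 1)),
      IsSemialgebraic ℚ (bandOver (U C) (ξ C.1) j) := fun C j => by
    rw [hbandU]
    exact ((hcells C.1 C.2).2 j).inter (hUsa C).setOf_init_mem
  -- the pieces: inner bands over the good parts of the cells of positive length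
  let I : Finset (Σ C : {C // C ∈ 𝒮}, Fin (l C.1 + 1)) :=
    (𝒮.attach.filter fun C => volume (C.1 : Set (Fin 1 → ℝ)) ≠ 0).sigma fun C => Bf C.1 C.2
  have hI : ∀ p : (Σ C : {C // C ∈ 𝒮}, Fin (l C.1 + 1)), p ∈ I ↔
      volume (p.1.1 : Set (Fin 1 → ℝ)) ≠ 0 ∧ p.2 ∈ Bf p.1.1 p.1.2 := by
    intro p
    simp [I]
  have hinner : ∀ p ∈ I, p.2 ≠ 0 ∧ p.2 ≠ Fin.last (l p.1.1) := fun p hp =>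
    KZ.ne_zero_and_ne_last_of_bandOver_subset hSm hfin
      (IsSemialgebraic.measurableSet_holds (h𝒮sa _ p.1.2)) ((hI p).1 hp).1 (ξ p.1.1)
      (hBsub p.1.1 p.1.2 p.2 ((hI p).1 hp).2)
  have hsubS : ∀ p ∈ I, bandOver (U p.1) (ξ p.1.1) p.2 ⊆ S := fun p hp z hz =>
    hBsub _ p.1.2 p.2 ((hI p).1 hp).2 ⟨hUC p.1 hz.1, hz.2⟩
  obtain ⟨ρ₀, -, -⟩ := KZ.exists_oneRep (n := 1) (isSemialgebraic_empty (k := ℚ)) (by simp)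
  have hpiece : ∀ p : (Σ C : {C // C ∈ 𝒮}, Fin (l C.1 + 1)),
      ∃ (Ob : KZ.IntegralRep 2) (ρ : KZ.IntegralRep 1), p ∈ I →
        Ob.domain = bandOver (U p.1) (ξ p.1.1) p.2 ∧ (Ob.integrand = fun _ => 1) ∧
          KZ.of Ob - Θ (KZ.of ρ) ∈ planarGroup ∧ ρ.value = Ob.value := by
    intro p
    by_cases hp : p ∈ I
    · obtain ⟨Ob, ρ, h1, h2, h3, h4⟩ := exists_band_piece Θ hΘ1 hfin (hUsa p.1) (ξ p.1.1)
        (fun i => (hsa _ p.1.2 i).mono (hUC p.1) (hUsa p.1))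
        (fun x hx => hmono _ p.1.2 x (hUC p.1 hx)) (fun i x hx => hUdiff p.1 i x hx)
        (hinner p hp).1 (hinner p hp).2 (hsubS p hp) (hbandsa p.1 p.2)
      exact ⟨Ob, ρ, fun _ => ⟨h1, h2, h3, h4⟩⟩
    · exact ⟨r, ρ₀, fun h => absurd h hp⟩
  choose Ob ρ hObρ using hpiece
  -- Step A: `[r] ≡ ∑ [Ob p]` (finite almost-partition)
  have hA : KZ.of r - ∑ p ∈ I, KZ.of (Ob p) ∈ planarGroup := by
    refine ElementaryMoves.of_sub_sum_mem_planarGroup I r Ob hr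
      (fun p hp q _ => by rw [(hObρ p hp).2.1]) (fun p hp => ?_) ?_ ?_
    · rw [(hObρ p hp).1, Set.sdiff_eq_empty.mpr (hsubS p hp), measure_empty]
    · -- the uncovered part of `S` is null
      let N : Set (Fin 2 → ℝ) := ⋃ C ∈ 𝒮.attach,
        (({z : Fin 2 → ℝ | Fin.init z ∈ C.1 \ U C} ∪
          ⋃ i ∈ (Finset.univ : Finset (Fin (l C.1))),
            {z : Fin 2 → ℝ | Fin.init z ∈ C.1 ∧ z (Fin.last 1) = ξ C.1 i (Fin.init z)}) ∪
          {z : Fin 2 → ℝ | Fin.init z ∈ C.1 ∧ volume (C.1 : Set (Fin 1 → ℝ)) = 0})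
      have hN0 : volume N = 0 := by
        refine (measure_biUnion_null_iff (Finset.countable_toSet _)).2 fun C _ => ?_
        refine measure_union_null (measure_union_null ?_ ?_) ?_
        · exact KZ.volume_setOf_init_mem_eq_zero (hU0 C)
        · exact (measure_biUnion_null_iff (Finset.countable_toSet _)).2 fun i _ =>
            KZ.volume_graph_eq_zero (hsa C.1 C.2 i)
        · by_cases hC0 : volume (C.1 : Set (Fin 1 → ℝ)) = 0
          · exact measure_mono_null (fun z hz => hz.1) (KZ.volume_setOf_init_mem_eq_zero hC0)
          · rw [show {z : Fin 2 → ℝ | Fin.init z ∈ C.1 ∧ volume (C.1 : Set (Fin 1 → ℝ)) = 0} = ∅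
              from eq_empty_of_forall_notMem fun z hz => hC0 hz.2, measure_empty]
      refine measure_mono_null (fun z hz => ?_) hN0
      obtain ⟨hzS, hzU⟩ := hz
      -- the base cell of `init z`
      obtain ⟨C, hC, hzC⟩ : ∃ C ∈ 𝒮, Fin.init z ∈ C := by
        have hcov : (Fin.init z : Fin 1 → ℝ) ∈ ⋃₀ (𝒮 : Set (Set (Fin 1 → ℝ))) := by
          rw [h𝒮part.sUnion_eq_univ]; exact mem_univ _
        obtain ⟨C, hC, hzC⟩ := mem_sUnion.1 hcov
        exact ⟨C, hC, hzC⟩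
      refine mem_iUnion₂.2 ⟨⟨C, hC⟩, Finset.mem_attach _ _, ?_⟩
      have ht : z (Fin.last 1) ∈ {t : ℝ | (Fin.snoc (Fin.init z) t : Fin 2 → ℝ) ∈ S} := by
        show Fin.snoc (Fin.init z) (z (Fin.last 1)) ∈ S
        rw [Fin.snoc_init_self]; exact hzS
      rw [hfibre C hC _ hzC] at ht
      rcases ht with ht | ht
      · simp only [mem_iUnion, mem_singleton_iff, exists_prop] at ht
        obtain ⟨i, -, hit⟩ := ht
        exact Or.inl (Or.inr (mem_iUnion₂.2 ⟨i, Finset.mem_univ _, hzC, hit⟩))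
      · simp only [mem_iUnion, mem_setOf_eq, exists_prop] at ht
        obtain ⟨j, hj, hjt⟩ := ht
        by_cases hC0 : volume C = 0
        · exact Or.inr ⟨hzC, hC0⟩
        by_cases hzU' : Fin.init z ∈ U ⟨C, hC⟩
        · have hp : (⟨⟨C, hC⟩, j⟩ : Σ C : {C // C ∈ 𝒮}, Fin (l C.1 + 1)) ∈ I := (hI _).2 ⟨hC0, hj⟩
          exact absurd (mem_iUnion₂.2 ⟨⟨⟨C, hC⟩, j⟩, hp, by
            rw [(hObρ _ hp).1]; exact ⟨hzU', hjt.1, hjt.2⟩⟩) hzU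
        · exact Or.inl (Or.inl ⟨hzC, hzU'⟩)
    · -- the pieces are pairwise disjoint
      intro p hp q hq hpq
      rw [(hObρ p hp).1, (hObρ q hq).1]
      obtain ⟨C, j⟩ := p
      obtain ⟨C', j'⟩ := q
      have : bandOver (U C) (ξ C.1) j ∩ bandOver (U C') (ξ C'.1) j' = ∅ := by
        ext z
        simp only [mem_inter_iff, mem_empty_iff_false, iff_false, not_and]
        intro hz hz'
        rw [mem_bandOver_iff] at hz hz'
        by_cases hCC : C = C'
        · subst hCC
          have hjj : j ≠ j' := fun h => hpq (by subst h; rfl)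
          exact (Set.disjoint_left.1 (KZ.disjoint_bandFibre (ξ C.1) (hmono C.1 C.2 _ (hUC C hz.1))
            hjj)) ⟨hz.2.1, hz.2.2⟩ ⟨hz'.2.1, hz'.2.2⟩
        · have hne : (C.1 : Set (Fin 1 → ℝ)) ≠ C'.1 := fun h => hCC (Subtype.ext h)
          exact (h𝒮part.pairwiseDisjoint C.2 C'.2 hne).ne_of_mem (hUC C hz.1) (hUC C' hz'.1) rfl
      rw [this, measure_empty]
  -- Step B: `[Ob p] ≡ Θ [ρ p]` termwise
  have hB : ∑ p ∈ I, KZ.of (Ob p) - ∑ p ∈ I, Θ (KZ.of (ρ p)) ∈ planarGroup :=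
    sum_sub_sum_mem_planarGroup I _ _ fun p hp => (hObρ p hp).2.2.1
  refine ⟨∑ p ∈ I, KZ.of (ρ p), sum_mem fun p _ => AddSubgroup.subset_closure ⟨ρ p, rfl⟩, ?_, ?_⟩
  · have h0 : KZ.eval (KZ.of r - ∑ p ∈ I, KZ.of (Ob p)) = 0 := eval_eq_zero_of_mem_planarGroup hA
    rw [map_sub, map_sum, KZ.eval_of, sub_eq_zero] at h0
    rw [map_sum, h0]
    refine Finset.sum_congr rfl fun p hp => ?_
    rw [KZ.eval_of, KZ.eval_of, (hObρ p hp).2.2.2]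
  · show KZ.of r - Θ (∑ p ∈ I, KZ.of (ρ p)) ∈ planarGroup
    rw [map_sum, show KZ.of r - ∑ p ∈ I, Θ (KZ.of (ρ p)) = (KZ.of r - ∑ p ∈ I, KZ.of (Ob p)) +
      (∑ p ∈ I, KZ.of (Ob p) - ∑ p ∈ I, Θ (KZ.of (ρ p))) by abel]
    exact planarGroup.add_mem hA hB

end Summit.KontsevichZagierPeriods.SymplecticScissors.PlanarCompilerProof
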